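import Mathlib
import Summits.Ventures.PercRepro.PuncturedLYMMixT1Q3Table1
import Summits.Ventures.PercRepro.PuncturedLYMMixT1Q3Table2

/-!
# PercRepro — (SP) FOR `1` PAIRWISE DISJOINT TRIPLES AND `3` PAIRWISE DISJOINT QUADRUPLES AT LEVEL `4`: POSITIVITY OF THE DENOMINATORS (1)
(p10, gen 41)

`den > 0`, `Pc > 0` for `n ≥ 15`; `Yc > 0` for `n ≥ 5`.  Nothing here asserts (SP).
-/

namespace PercRepro.PuncturedLYM.Split.TypeLift.MixT1Q3

/-- `den > 0` for `n ≥ 15`. -/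
theorem den_pos (n : ℚ) (hn : 15 ≤ n) : 0 < den n := by
  obtain ⟨n', hn', rfl⟩ : ∃ n', 0 ≤ n' ∧ n = 15 + n' := ⟨n - 15, by linarith, by ring⟩
  have h : den (15 + n') = 20736 * n' ^ 13 + 3604608 * n' ^ 12 + 289076688 * n' ^ 11 + 14160484656 * n' ^ 10 + 472690004580 * n' ^ 9 + 11353918433592 * n' ^ 8 + 201879771295392 * n' ^ 7 + 2690199299288280 * n' ^ 6 + 26865295421585148 * n' ^ 5 + 198558809531191488 * n' ^ 4 + 1055631246360537456 * n' ^ 3 + 3822652830139730496 * n' ^ 2 + 8450173334800502784 * n' + 8611292667609354240 := by unfold den; ring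
  rw [h]; positivity

/-- `Yc > 0` for `n ≥ 5`. -/
theorem Yc_pos (n : ℚ) (hn : 5 ≤ n) : 0 < Yc n := by
  obtain ⟨n', hn', rfl⟩ : ∃ n', 0 ≤ n' ∧ n = 5 + n' := ⟨n - 5, by linarith, by ring⟩
  have h : Yc (5 + n') = (1 / 120) * n' ^ 5 + (1 / 8) * n' ^ 4 + (17 / 24) * n' ^ 3 + (15 / 8) * n' ^ 2 + (137 / 60) * n' + 1 := by unfold Yc; ring
  rw [h]; positivity

/-- `Pc > 0` for `n ≥ 15`. -/
theorem Pc_pos (n : ℚ) (hn : 15 ≤ n) : 0 < Pc n := by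
  obtain ⟨n', hn', rfl⟩ : ∃ n', 0 ≤ n' ∧ n = 15 + n' := ⟨n - 15, by linarith, by ring⟩
  have h : Pc (15 + n') = (1 / 24) * n' ^ 4 + (9 / 4) * n' ^ 3 + (1091 / 24) * n' ^ 2 + (1625 / 4) * n' + 1350 := by unfold Pc; ring
  rw [h]; positivity

end PercRepro.PuncturedLYM.Split.TypeLift.MixT1Q3
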